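import Summits.Ventures.PercRepro.S1CoreCapSpecSpreadSixBase

/-!
# PercRepro — TOWARDS THE INSTANCE `ν = 6` OF THE SPREAD SPEC: THE ALL-SIMPLE COUNTS AT ANY NULLITY, AND `≤ 5` AT COST `4` (p1, gen 32)

`proofs/P1-S2-CORANK6.md` §4h. The three counts of the `ν = 5` all-simple modules, with the nullity as a parameter and the bounds on the
lines disjoint from / meeting the base as hypotheses: `card_le_of_triangle_gen` (`≤ 4 + d`, `d` = the lines disjoint from the triangle),
`tf_count_gen` (`≤ 3 + w + d`), `pencil_count_gen` (`≤ p + d`, `p ≤ ν` lines through the centre, `d` bounded by the base of `min p 4` of them).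
At cost `≤ 4` the lines meeting the triangle-free base once are at most one (`tf_W_le_one_four`: two of them cost `3 + 1 + 1`), so **every
all-simple configuration of cost `≤ 4` under the spread clause has at most `5` lines** (`card_le_five_of_three_points_spread_four`; the
`ν = 4` instance needed only `≤ 6`) — the count needed beside a simple 4-line at `ν = 6`. Axioms: standard.
-/

namespace PercRepro

namespace S1

namespace FourCap

variable {β : Type} [DecidableEq β]

section GenLines

variable {w : β → ℕ} {ls : Finset (Finset β)}
  (hw1 : ∀ L ∈ ls, ∀ v ∈ L, w v = 1)
  (hcard : ∀ L ∈ ls, L.card = 3)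
  (h3 : ∀ L ∈ ls, ∀ L' ∈ ls, L ≠ L' → (L ∩ L').card ≤ 1)
  (h7 : ∀ l : List (Finset β), l.Nodup → (∀ L ∈ l, L ∈ ls) → lineRank l ≤ 4 → wsum w (unionL l) ≤ lineRank l + 3)

include hw1 hcard h3 h7 in
/-- **The triangle count at any nullity**: the three lines, at most one inside, and the lines disjoint from the triangle. -/
theorem card_le_of_triangle_gen {X Y Z : Finset β} (hX : X ∈ ls) (hY : Y ∈ ls) (hZ : Z ∈ ls) (hYX : Y ≠ X) (hZX : Z ≠ X)
    (hZY : Z ≠ Y) {a b c : β} (hcX : c ∈ X) (hcY : c ∈ Y) (haY : a ∈ Y) (haZ : a ∈ Z) (hbX : b ∈ X) (hbZ : b ∈ Z)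
    (hab : a ≠ b) (hac : a ≠ c) (hbc : b ≠ c) {d : ℕ} (hD : (ls.filter (fun L => Disjoint L (unionL [Z, Y, X]))).card ≤ d) :
    ls.card ≤ 4 + d := by
  set 𝓘 := ls.filter (fun L => L ≠ X ∧ L ≠ Y ∧ L ≠ Z ∧ L ⊆ unionL [Z, Y, X]) with h𝓘
  have hI : 𝓘.card ≤ 1 := by
    refine Finset.card_le_one.2 (fun W hW W' hW' => ?_)
    rw [h𝓘, Finset.mem_filter] at hW hW'
    exact triangle_inside_eq hcard h3 hX hY hZ hYX hZX hZY hcX hcY haY haZ hbX hbZ hab hac hbc hW.1 hW.2.1 hW.2.2.1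
      hW.2.2.2.1 hW.2.2.2.2 hW'.1 hW'.2.1 hW'.2.2.1 hW'.2.2.2.1 hW'.2.2.2.2
  have hcover : ls ⊆ ({X, Y, Z} : Finset (Finset β)) ∪ (𝓘 ∪ ls.filter (fun L => Disjoint L (unionL [Z, Y, X]))) := by
    intro W hW
    rw [Finset.mem_union, Finset.mem_union, Finset.mem_insert, Finset.mem_insert, Finset.mem_singleton]
    by_cases hWX : W = X
    · exact Or.inl (Or.inl hWX)
    by_cases hWY : W = Y
    · exact Or.inl (Or.inr (Or.inl hWY))
    by_cases hWZ : W = Z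
    · exact Or.inl (Or.inr (Or.inr hWZ))
    rcases triangle_other hw1 hcard h3 h7 hX hY hZ hYX hZX hZY hcX hcY haY haZ hbX hbZ hab hW hWX hWY hWZ with hd | hs
    · exact Or.inr (Or.inr (Finset.mem_filter.2 ⟨hW, hd⟩))
    · exact Or.inr (Or.inl (Finset.mem_filter.2 ⟨hW, hWX, hWY, hWZ, hs⟩))
  have hc := Finset.card_le_card hcover
  have hu1 := Finset.card_union_le ({X, Y, Z} : Finset (Finset β)) (𝓘 ∪ ls.filter (fun L => Disjoint L (unionL [Z, Y, X])))
  have hu2 := Finset.card_union_le 𝓘 (ls.filter (fun L => Disjoint L (unionL [Z, Y, X])))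
  have h3' : ({X, Y, Z} : Finset (Finset β)).card ≤ 3 := Finset.card_le_three
  omega

include hw1 hcard h3 h7 in
/-- **The triangle-free count at any nullity**: `A, X, Y`, the lines meeting the base once (`≤ w`), the lines disjoint from it (`≤ d`). -/
theorem tf_count_gen
    (htf : ∀ X ∈ ls, ∀ Y ∈ ls, ∀ Z ∈ ls, X ≠ Y → Y ≠ Z → X ≠ Z → (X ∩ Y).Nonempty → (Y ∩ Z).Nonempty →
      (X ∩ Z).Nonempty → (X ∩ Y ∩ Z).Nonempty)
    {A X Y : Finset β} (hA : A ∈ ls) (hX : X ∈ ls) (hY : Y ∈ ls) (hAX : A ≠ X) (hYA : Y ≠ A) (hYX' : Y ≠ X) {a : β}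
    (haA : a ∈ A) (haX : a ∈ X) (haY : a ∉ Y) (hmeet : (Y ∩ A).Nonempty) {wb d : ℕ}
    (hW : (ls.filter (fun L => L ≠ A ∧ L ≠ X ∧ L ≠ Y ∧ (L ∩ unionL [Y, X, A]).card = 1)).card ≤ wb)
    (hD : (ls.filter (fun L => Disjoint L (unionL [Y, X, A]))).card ≤ d) : ls.card ≤ 3 + wb + d := by
  have hYX : Disjoint Y X := tf_disjoint_of_meet h3 htf hA hX hY hAX hYA hYX' haA haX haY hmeet
  have hcover : ls ⊆ ({A, X, Y} : Finset (Finset β)) ∪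
      (ls.filter (fun L => L ≠ A ∧ L ≠ X ∧ L ≠ Y ∧ (L ∩ unionL [Y, X, A]).card = 1) ∪
        ls.filter (fun L => Disjoint L (unionL [Y, X, A]))) := by
    intro W hW
    rw [Finset.mem_union, Finset.mem_union, Finset.mem_insert, Finset.mem_insert, Finset.mem_singleton]
    by_cases hWA : W = A
    · exact Or.inl (Or.inl hWA)
    by_cases hWX : W = X
    · exact Or.inl (Or.inr (Or.inl hWX))
    by_cases hWY : W = Y
    · exact Or.inl (Or.inr (Or.inr hWY))
    have hle := tf_other_le_one hw1 hcard h3 h7 htf hA hX hY hAX hYA hYX' haA haX haY hmeet hYX hW hWA hWX hWY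
    rcases (by omega : (W ∩ unionL [Y, X, A]).card = 1 ∨ (W ∩ unionL [Y, X, A]).card = 0) with h | h
    · exact Or.inr (Or.inl (Finset.mem_filter.2 ⟨hW, hWA, hWX, hWY, h⟩))
    · refine Or.inr (Or.inr (Finset.mem_filter.2 ⟨hW, ?_⟩))
      rw [Finset.disjoint_iff_inter_eq_empty]
      exact Finset.card_eq_zero.1 h
  have hc := Finset.card_le_card hcover
  have hu1 := Finset.card_union_le ({A, X, Y} : Finset (Finset β))
    (ls.filter (fun L => L ≠ A ∧ L ≠ X ∧ L ≠ Y ∧ (L ∩ unionL [Y, X, A]).card = 1) ∪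
      ls.filter (fun L => Disjoint L (unionL [Y, X, A])))
  have hu2 := Finset.card_union_le (ls.filter (fun L => L ≠ A ∧ L ≠ X ∧ L ≠ Y ∧ (L ∩ unionL [Y, X, A]).card = 1))
    (ls.filter (fun L => Disjoint L (unionL [Y, X, A])))
  have h3' : ({A, X, Y} : Finset (Finset β)).card ≤ 3 := Finset.card_le_three
  omega

include hw1 hcard h3 in
/-- **The two-line pencil base** `[X, A]` through `a` has rank `3` on `5` points; the three-line base `[X', X, A]` has rank `4` on `7`. -/
theorem pencil_bases {a : β} {A X : Finset β} (hA : A ∈ ls) (hX : X ∈ ls) (hAX : A ≠ X) (haA : a ∈ A) (haX : a ∈ X) :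
    lineRank [X, A] = 3 ∧ wsum w (unionL [X, A]) = 5 := by
  obtain ⟨hr, hu⟩ := pencil_list hcard h3 (a := a) [X, A] (by simp [hAX.symm]) (by simp [hA, hX, haA, haX]) (by simp)
  simp only [List.length_cons, List.length_nil] at hr hu
  refine ⟨hr, ?_⟩
  rw [wsum_unionL_eq_card hw1 _ (by simp [hA, hX]), hu]

include hw1 hcard h3 in
/-- The three-line pencil base `[X', X, A]` has rank `4` on `7` points. -/
theorem pencil_base_three {a : β} {A X X' : Finset β} (hA : A ∈ ls) (hX : X ∈ ls) (hX' : X' ∈ ls) (hAX : A ≠ X)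
    (hX'A : X' ≠ A) (hX'X : X' ≠ X) (haA : a ∈ A) (haX : a ∈ X) (haX' : a ∈ X') :
    lineRank [X', X, A] = 4 ∧ wsum w (unionL [X', X, A]) = 7 := by
  obtain ⟨hr, hu⟩ := pencil_list hcard h3 (a := a) [X', X, A] (by simp [hAX.symm, hX'A, hX'X])
    (by simp [hA, hX, hX', haA, haX, haX']) (by simp)
  simp only [List.length_cons, List.length_nil] at hr hu
  refine ⟨hr, ?_⟩
  rw [wsum_unionL_eq_card hw1 _ (by simp [hA, hX, hX']), hu]

include hw1 hcard h3 in
/-- The four-line pencil base `[X'', X', X, A]` has rank `5` on `9` points. -/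
theorem pencil_base_four {a : β} {A X X' X'' : Finset β} (hA : A ∈ ls) (hX : X ∈ ls) (hX' : X' ∈ ls) (hX'' : X'' ∈ ls)
    (hAX : A ≠ X) (hX'A : X' ≠ A) (hX'X : X' ≠ X) (hX''A : X'' ≠ A) (hX''X : X'' ≠ X) (hX''X' : X'' ≠ X') (haA : a ∈ A)
    (haX : a ∈ X) (haX' : a ∈ X') (haX'' : a ∈ X'') :
    lineRank [X'', X', X, A] = 5 ∧ wsum w (unionL [X'', X', X, A]) = 9 := by
  obtain ⟨hr, hu⟩ := pencil_list hcard h3 (a := a) [X'', X', X, A] (by simp [hAX.symm, hX'A, hX'X, hX''A, hX''X, hX''X'])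
    (by simp [hA, hX, hX', hX'', haA, haX, haX', haX'']) (by simp)
  simp only [List.length_cons, List.length_nil] at hr hu
  refine ⟨hr, ?_⟩
  rw [wsum_unionL_eq_card hw1 _ (by simp [hA, hX, hX', hX'']), hu]

include hw1 hcard h3 in
/-- **At most `ν` lines through a point** (a pencil list of `n` lines costs `n`). -/
theorem card_pencil_le_gen {ν : ℕ}
    (h4 : ∀ l : List (Finset β), l.Nodup → (∀ L ∈ l, L ∈ ls) → wsum w (unionL l) ≤ ν + lineRank l) {a : β} :
    (ls.filter (fun L => a ∈ L)).card ≤ ν := by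
  set P := ls.filter (fun L => a ∈ L) with hP
  rcases Finset.eq_empty_or_nonempty P with h0 | hne
  · rw [h0]; simp
  have hl : ∀ L ∈ P.toList, L ∈ ls ∧ a ∈ L := fun L hL => Finset.mem_filter.1 (Finset.mem_toList.1 hL)
  have hnil : P.toList ≠ [] := by
    rw [Ne, Finset.toList_eq_nil]
    exact Finset.nonempty_iff_ne_empty.1 hne
  obtain ⟨h1, h2⟩ := pencil_list hcard h3 P.toList (Finset.nodup_toList P) hl hnil
  have hc := h4 P.toList (Finset.nodup_toList P) (fun L hL => (hl L hL).1)
  rw [wsum_unionL_eq_card hw1 _ (fun L hL => (hl L hL).1), h1, h2, Finset.length_toList] at hc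
  omega

include hw1 hcard h3 in
/-- **The pencil count at any nullity**: the lines through `a` (`≤ ν`) and the lines avoiding `a`, which are disjoint from every line through
`a`; the latter are bounded through a base of `2`, `3` or `4` pencil lines (`hD₂`, `hD₃`, `hD₄` supply the bounds for those bases). -/
theorem pencil_count_gen {ν : ℕ}
    (h4 : ∀ l : List (Finset β), l.Nodup → (∀ L ∈ l, L ∈ ls) → wsum w (unionL l) ≤ ν + lineRank l) {a : β}
    {A X : Finset β} (hA : A ∈ ls) (hX : X ∈ ls) (hAX : A ≠ X) (haA : a ∈ A) (haX : a ∈ X)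
    (hno : ∀ Y ∈ ls, a ∉ Y → ∀ B ∈ ls, a ∈ B → Disjoint Y B) {d₂ d₃ d₄ : ℕ}
    (hD₂ : ∀ {b : List (Finset β)}, b.Nodup → (∀ L ∈ b, L ∈ ls) → lineRank b = 3 → wsum w (unionL b) = 5 →
      (ls.filter (fun L => Disjoint L (unionL b))).card ≤ d₂)
    (hD₃ : ∀ {b : List (Finset β)}, b.Nodup → (∀ L ∈ b, L ∈ ls) → lineRank b = 4 → wsum w (unionL b) = 7 →
      (ls.filter (fun L => Disjoint L (unionL b))).card ≤ d₃)
    (hD₄ : ∀ {b : List (Finset β)}, b.Nodup → (∀ L ∈ b, L ∈ ls) → lineRank b = 5 → wsum w (unionL b) = 9 →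
      (ls.filter (fun L => Disjoint L (unionL b))).card ≤ d₄) :
    ls.card ≤ 2 + d₂ ∨ ls.card ≤ 3 + d₃ ∨ ls.card ≤ ν + d₄ := by
  have hsplit := Finset.card_filter_add_card_filter_not (fun L => a ∈ L) (s := ls)
  have hP := card_pencil_le_gen hw1 hcard h3 h4 (a := a)
  have hAP : A ∈ ls.filter (fun L => a ∈ L) := Finset.mem_filter.2 ⟨hA, haA⟩
  have hXP : X ∈ ls.filter (fun L => a ∈ L) := Finset.mem_filter.2 ⟨hX, haX⟩
  have hdisjU : ∀ (b : List (Finset β)), (∀ L ∈ b, L ∈ ls ∧ a ∈ L) →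
      ls.filter (fun L => ¬ a ∈ L) ⊆ ls.filter (fun L => Disjoint L (unionL b)) := by
    intro b hb Y hY
    rw [Finset.mem_filter] at hY ⊢
    refine ⟨hY.1, disjoint_unionL_of_forall (fun B hB => (hno Y hY.1 hY.2 B (hb B hB).1 (hb B hB).2).symm) |>.symm⟩
  by_cases hbig : 2 < (ls.filter (fun L => a ∈ L)).card
  · obtain ⟨X', hX'P, hX'A, hX'X⟩ := exists_third hbig hAP hXP hAX
    obtain ⟨hX', haX'⟩ := Finset.mem_filter.1 hX'P
    by_cases hbig' : 3 < (ls.filter (fun L => a ∈ L)).card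
    · -- four pencil lines
      have hX'P' : X' ∈ (ls.filter (fun L => a ∈ L)).erase A := Finset.mem_erase.2 ⟨hX'A, hX'P⟩
      have hXP' : X ∈ ((ls.filter (fun L => a ∈ L)).erase A).erase X' :=
        Finset.mem_erase.2 ⟨hX'X.symm, Finset.mem_erase.2 ⟨hAX.symm, hXP⟩⟩
      have hpos : 0 < ((((ls.filter (fun L => a ∈ L)).erase A).erase X').erase X).card := by
        rw [Finset.card_erase_of_mem hXP', Finset.card_erase_of_mem hX'P', Finset.card_erase_of_mem hAP]
        omega
      obtain ⟨X'', hX''⟩ := Finset.card_pos.1 hpos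
      simp only [Finset.mem_erase, Finset.mem_filter] at hX''
      obtain ⟨hX''X, hX''X', hX''A, hX''ls, haX''⟩ := hX''
      obtain ⟨hr, hu⟩ := pencil_base_four hw1 hcard h3 hA hX hX' hX''ls hAX hX'A hX'X hX''A hX''X hX''X' haA haX haX' haX''
      have hD := hD₄ (by simp [hAX.symm, hX'A, hX'X, hX''A, hX''X, hX''X']) (by simp [hA, hX, hX', hX''ls]) hr hu
      have := Finset.card_le_card (hdisjU [X'', X', X, A] (by simp [hA, hX, hX', hX''ls, haA, haX, haX', haX'']))
      right; right; omega
    · -- exactly three pencil lines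
      obtain ⟨hr, hu⟩ := pencil_base_three hw1 hcard h3 hA hX hX' hAX hX'A hX'X haA haX haX'
      have hD := hD₃ (by simp [hAX.symm, hX'A, hX'X]) (by simp [hA, hX, hX']) hr hu
      have := Finset.card_le_card (hdisjU [X', X, A] (by simp [hA, hX, hX', haA, haX, haX']))
      right; left; omega
  · -- exactly two pencil lines
    obtain ⟨hr, hu⟩ := pencil_bases hw1 hcard h3 hA hX hAX haA haX
    have hD := hD₂ (by simp [hAX.symm]) (by simp [hA, hX]) hr hu
    have := Finset.card_le_card (hdisjU [X, A] (by simp [hA, hX, haA, haX]))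
    left; omega

include hw1 hcard h3 in
/-- **At cost `≤ 4` at most one line meets the triangle-free base once**: two of them are both free over the base (`3 + 1 + 1 = 5`). -/
theorem tf_W_le_one_four
    (h4 : ∀ l : List (Finset β), l.Nodup → (∀ L ∈ l, L ∈ ls) → wsum w (unionL l) ≤ 4 + lineRank l)
    {A X Y : Finset β} (hA : A ∈ ls) (hX : X ∈ ls) (hY : Y ∈ ls) (hAX : A ≠ X) (hYA : Y ≠ A) (hYX' : Y ≠ X)
    (hrank : lineRank [Y, X, A] = 4) (hcardU : (unionL [Y, X, A]).card = 7) :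
    (ls.filter (fun L => L ≠ A ∧ L ≠ X ∧ L ≠ Y ∧ (L ∩ unionL [Y, X, A]).card = 1)).card ≤ 1 := by
  by_contra hlt
  push Not at hlt
  obtain ⟨Z₁, Z₂, hZ₁, hZ₂, h12⟩ := Finset.one_lt_card_iff.1 hlt
  simp only [Finset.mem_filter] at hZ₁ hZ₂
  obtain ⟨hZ₁, h1A, h1X, h1Y, k1⟩ := hZ₁
  obtain ⟨hZ₂, h2A, h2X, h2Y, k2⟩ := hZ₂
  have hw : ∀ L ∈ ls, ∀ v ∈ L, 1 ≤ w v := fun L hL v hv => by rw [hw1 L hL v hv]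
  have hc := h4 [Z₂, Z₁, Y, X, A] (by simp [hAX.symm, hYA, hYX', h1A, h1X, h1Y, h2A, h2X, h2Y, h12.symm])
    (by simp [hA, hX, hY, hZ₁, hZ₂])
  obtain ⟨a1, b1, c1, d1⟩ := cost_step w Z₁ [Y, X, A] (hw Z₁ hZ₁)
  obtain ⟨a2, b2, c2, d2⟩ := cost_step w Z₂ [Z₁, Y, X, A] (hw Z₂ hZ₂)
  have w1 := wsum_sdiff_eq_card hw1 hZ₁ (unionL [Y, X, A])
  have w2 := wsum_sdiff_eq_card hw1 hZ₂ (unionL [Z₁, Y, X, A])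
  have hwU : wsum w (unionL [Y, X, A]) = 7 := by
    rw [wsum_unionL_eq_card hw1 _ (by simp [hA, hX, hY]), hcardU]
  have e2 : unionL [Z₁, Y, X, A] = Z₁ ∪ unionL [Y, X, A] := rfl
  have i2 : (Z₂ ∩ unionL [Z₁, Y, X, A]).card ≤ 2 := by
    rw [e2, Finset.inter_union_distrib_left]
    refine (Finset.card_union_le _ _).trans ?_
    have := h3 Z₂ hZ₂ Z₁ hZ₁ h12.symm
    omega
  have kZ₁ := hcard Z₁ hZ₁
  have kZ₂ := hcard Z₂ hZ₂
  rw [a2, a1, hwU, w1, w2, c2, c1, hrank] at hc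
  omega

include hw1 hcard h3 h7 in
/-- **Every all-simple configuration of cost `≤ 4` under the spread clause has at most five lines** (the `ν = 4` instance used `≤ 6`; the
search's maximum is `5`): a triangle ⟹ `4 + 1`; triangle-free with a line off the pencil centre ⟹ `3 + 1 + 1`; the pencil ⟹ `2 + 2`,
`3 + 1`, `4 + 0`; pairwise disjoint ⟹ `4`. -/
theorem card_le_five_of_three_points_spread_four
    (h4 : ∀ l : List (Finset β), l.Nodup → (∀ L ∈ l, L ∈ ls) → wsum w (unionL l) ≤ 4 + lineRank l) : ls.card ≤ 5 := by
  have h1' := h1_of_simple hw1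
  have h2' := h2_of_simple hw1 hcard
  by_cases htri : ∃ X ∈ ls, ∃ Y ∈ ls, ∃ Z ∈ ls, X ≠ Y ∧ Y ≠ Z ∧ X ≠ Z ∧ (X ∩ Y).Nonempty ∧ (Y ∩ Z).Nonempty ∧
      (X ∩ Z).Nonempty ∧ X ∩ Y ∩ Z = ∅
  · obtain ⟨X, hX, Y, hY, Z, hZ, hXY, hYZ, hXZ, ⟨c, hc⟩, ⟨a, ha⟩, ⟨b, hb⟩, hempty⟩ := htri
    rw [Finset.mem_inter] at hc ha hb
    have hab : a ≠ b := by
      rintro rfl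
      exact Finset.notMem_empty a (hempty ▸ Finset.mem_inter.2 ⟨Finset.mem_inter.2 ⟨hb.1, ha.1⟩, ha.2⟩)
    have hac : a ≠ c := by
      rintro rfl
      exact Finset.notMem_empty a (hempty ▸ Finset.mem_inter.2 ⟨Finset.mem_inter.2 ⟨hc.1, hc.2⟩, ha.2⟩)
    have hbc : b ≠ c := by
      rintro rfl
      exact Finset.notMem_empty b (hempty ▸ Finset.mem_inter.2 ⟨Finset.mem_inter.2 ⟨hb.1, hc.2⟩, hb.2⟩)
    obtain ⟨hrank, hcardU⟩ := triangle_base hcard h3 hX hY hZ hXY.symm hXZ.symm hYZ.symm hc.1 hc.2 ha.1 ha.2 hb.1 hb.2 hab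
    have hb' : ([Z, Y, X] : List (Finset β)).Nodup := by simp [hXY.symm, hXZ.symm, hYZ.symm]
    have hbl : ∀ L ∈ ([Z, Y, X] : List (Finset β)), L ∈ ls := by simp [hX, hY, hZ]
    have hwU : wsum w (unionL [Z, Y, X]) = 6 := by rw [wsum_unionL_eq_card hw1 _ hbl, hcardU]
    have hD := card_filter_disjoint_le_one_gen h1' h2' h3 h4 hb' hbl (by rw [hrank, hwU])
    exact card_le_of_triangle_gen hw1 hcard h3 h7 hX hY hZ hXY.symm hXZ.symm hYZ.symm hc.1 hc.2 ha.1 ha.2 hb.1 hb.2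
      hab hac hbc hD
  · push Not at htri
    by_cases hmeet : ∃ A ∈ ls, ∃ X ∈ ls, A ≠ X ∧ (A ∩ X).Nonempty
    · obtain ⟨A, hA, X, hX, hAX, ⟨a, ha⟩⟩ := hmeet
      rw [Finset.mem_inter] at ha
      by_cases hY : ∃ B ∈ ls, a ∈ B ∧ ∃ Y ∈ ls, a ∉ Y ∧ (Y ∩ B).Nonempty
      · obtain ⟨B, hB, haB, Y, hYl, haY, hYB⟩ := hY
        have hYB' : Y ≠ B := fun h => haY (h ▸ haB)
        -- the triangle-free base on `B`, a second pencil line `B'`, and `Y`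
        have key : ∀ {B' : Finset β}, B' ∈ ls → B ≠ B' → a ∈ B' → ls.card ≤ 5 := by
          intro B' hB' hBB' haB'
          have hYB'' : Y ≠ B' := fun h => haY (h ▸ haB')
          have hYB'd : Disjoint Y B' := tf_disjoint_of_meet h3 htri hB hB' hYl hBB' hYB' hYB'' haB haB' haY hYB
          obtain ⟨hrank, hcardU⟩ := tf_base hcard h3 hB hB' hYl hBB' hYB' haB haB' hYB hYB'd
          have hb' : ([Y, B', B] : List (Finset β)).Nodup := by simp [hBB'.symm, hYB', hYB'']
          have hbl : ∀ L ∈ ([Y, B', B] : List (Finset β)), L ∈ ls := by simp [hB, hB', hYl]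
          have hwU : wsum w (unionL [Y, B', B]) = 7 := by rw [wsum_unionL_eq_card hw1 _ hbl, hcardU]
          have hD := card_filter_disjoint_le_one_gen h1' h2' h3 h4 hb' hbl (by rw [hrank, hwU])
          have hW := tf_W_le_one_four hw1 hcard h3 h4 hB hB' hYl hBB' hYB' hYB'' hrank hcardU
          exact tf_count_gen hw1 hcard h3 h7 htri hB hB' hYl hBB' hYB' hYB'' haB haB' haY hYB hW hD
        by_cases hBA : B = A
        · subst hBA
          exact key hX hAX ha.2
        · exact key hA hBA ha.1
      · push Not at hY
        have hno : ∀ Y ∈ ls, a ∉ Y → ∀ B ∈ ls, a ∈ B → Disjoint Y B := fun Y hYl haY B hB haB => by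
          rw [Finset.disjoint_iff_inter_eq_empty]
          exact hY B hB haB Y hYl haY
        rcases pencil_count_gen hw1 hcard h3 h4 (d₂ := 2) (d₃ := 1) (d₄ := 0) hA hX hAX ha.1 ha.2 hno
          (fun {b} hb hbl hr hu => card_filter_disjoint_le_two_gen h1' h2' h3 h4 hb hbl (by rw [hr, hu]))
          (fun {b} hb hbl hr hu => card_filter_disjoint_le_one_gen h1' h2' h3 h4 hb hbl (by rw [hr, hu]))
          (fun {b} hb hbl hr hu => by
            -- four pencil lines cost `4`: no line avoids the centre
            rw [Nat.le_zero, Finset.card_eq_zero, Finset.filter_eq_empty_iff]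
            intro L hL hdis
            have hc := h4 (L :: b) (List.nodup_cons.2 ⟨fun hLb => not_disjoint_unionL_of_mem h2' hbl hLb hdis, hb⟩)
              (by intro L' hL'; rw [List.mem_cons] at hL'; rcases hL' with rfl | hL'; exact hL; exact hbl L' hL')
            obtain ⟨a1, b1, c1, d1⟩ := cost_step w L b (fun v hv => by rw [hw1 L hL v hv])
            have hs : L \ unionL b = L := Finset.sdiff_eq_self_of_disjoint hdis
            have hi : (L ∩ unionL b).card = 0 := by
              rw [Finset.card_eq_zero]; exact Finset.disjoint_iff_inter_eq_empty.1 hdis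
            have := wsum_eq_card_simple hw1 hL
            have := hcard L hL
            rw [a1, c1, hr, hu, hs, hi] at hc
            have : min 3 (2 - min 0 2) = 2 := by decide
            omega) with h | h | h
        · omega
        · omega
        · omega
    · push Not at hmeet
      exact (card_le_nu_of_pairwise_disjoint hw1 hcard (ν := 4) h4 (fun L hL L' hL' hne => by
        rw [Finset.disjoint_iff_inter_eq_empty]; exact hmeet L hL L' hL' hne)).trans (by norm_num)

end GenLines

end FourCap

end S1

end PercRepro
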